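import Summits.CriticalPhenomena.CardyFormulaZ2.Theorems.CardySusyWardDiscretisationFamilyExistsAssemblyA
import HarnessLib

/-!
# Simultaneous labellings for two chords of a `3`-marked domain at a common diagonal tolerance:
helper for stub `stub_discreteSplitting` of line `hitting-tournament` for crux `LagHandOff`
(stmt-CriticalPhenomena-10268)

`splitting_labels`: for a `3`-marked Jordan domain `(D; x₀, x₁, x₂)` there are label families
`SA δ ⊔ SB δ` (for the chord `(x₀, x₂)`) and `SA' δ ⊔ SB' δ` (for the chord `(x₁, x₂)`) of the
square-lattice boundary of the canonical discrete domain and ONE tolerance `ε δ → 0⁺` such that, for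
all small meshes, both labellings have the ten properties of `eventually_labelling`
(`Theorems/CardySusyWardDiscretisationFamilyExistsAssemblyA.lean`) at tolerance `ε δ`, with the cut
midpoints within `ε δ` of the respective marked points.  Assembly: `eventually_labelling` for the two
chords, the infimum trick (a diagonal tolerance, inlined as in `stub_discretisable`), and a choice
of witnesses along the filter.
-/

noncomputable section

open MeasureTheory Filter Set Topology
open Literature.Probability.Percolation Literature.Probability.LatticeModels
open Literature.Probability.RandomPlanarGeometry
open Summit.CriticalPhenomena.CardyFormulaZ2.Theorems.DiscretisationFamilyExists

namespace Summit.CriticalPhenomena.CardyFormulaZ2.Cruxes.LagHandOff.HittingTournament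

/-- A choice of two witnesses along a filter. -/
theorem exists_fun₂_of_eventually_exists {α β γ : Type*} [Nonempty β] [Nonempty γ] {l : Filter α}
    {Q : α → β → γ → Prop} (h : ∀ᶠ a in l, ∃ b c, Q a b c) :
    ∃ (f : α → β) (g : α → γ), ∀ᶠ a in l, Q a (f a) (g a) := by
  classical
  refine ⟨fun a => if hx : ∃ b c, Q a b c then hx.choose else Classical.arbitrary β,
    fun a => if hx : ∃ b c, Q a b c then hx.choose_spec.choose else Classical.arbitrary γ,
    h.mono fun a ha => ?_⟩
  simp only [dif_pos ha]
  exact ha.choose_spec.choose_spec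

set_option maxHeartbeats 1600000 in
/-- **Simultaneous labellings for the chords `(x₀, x₂)` and `(x₁, x₂)`.** See the module
docstring. -/
theorem splitting_labels (D : MarkedDomain 3) :
    ∃ (SA SB SA' SB' : ℝ → Set (Site 2)) (ε : ℝ → ℝ), Tendsto ε (𝓝[>] 0) (𝓝 0) ∧
      ∀ᶠ δ in 𝓝[>] (0 : ℝ), 0 < ε δ ∧
      ((SA δ ∪ SB δ = (⟨D.carrier, δ, ∅, ∅⟩ : DiscreteDobrushin).zdBoundary ∧
        Disjoint (SA δ) (SB δ) ∧ (SA δ).Nonempty ∧ (SB δ).Nonempty ∧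
        (∀ y ∈ SA δ, ¬ Metric.closedBall (meshPoint δ y)
            (Metric.infDist (meshPoint δ y) (frontier D.carrier)) ⊆
          ⋃ x ∈ SB δ, Metric.closedBall (meshPoint δ x)
            (Metric.infDist (meshPoint δ x) (frontier D.carrier))) ∧
        (∀ x ∈ SB δ, ¬ Metric.closedBall (meshPoint δ x)
            (Metric.infDist (meshPoint δ x) (frontier D.carrier)) ⊆
          ⋃ y ∈ SA δ, Metric.closedBall (meshPoint δ y)
            (Metric.infDist (meshPoint δ y) (frontier D.carrier))) ∧
        (∀ y ∈ SA δ, Metric.infDist (meshPoint δ y) ((D.chord 0 2 (by decide)).arc 0) ≤ ε δ) ∧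
        (∀ x ∈ SB δ, Metric.infDist (meshPoint δ x) ((D.chord 0 2 (by decide)).arc 1) ≤ ε δ) ∧
        {e | e ∈ (discreteDomainGraph D.carrier δ).edgeSet ∧ (∃ x ∈ e, x ∈ SA δ) ∧
          ∃ y ∈ e, y ∈ SB δ}.ncard = 2 ∧
        ∀ e ∈ (discreteDomainGraph D.carrier δ).edgeSet, (∃ x ∈ e, x ∈ SA δ) → (∃ y ∈ e, y ∈ SB δ) →
          ∃! f, (⟨D.carrier, δ, ∅, ∅⟩ : DiscreteDobrushin).IsInnerFace f ∧ ∀ x ∈ e, IsCorner x f) ∧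
      Metric.hausdorffEDist (medialPoint δ ''
        {e | e ∈ (discreteDomainGraph D.carrier δ).edgeSet ∧ (∃ x ∈ e, x ∈ SA δ) ∧
          ∃ y ∈ e, y ∈ SB δ}) {D.pt 0, D.pt 2} ≤ ENNReal.ofReal (ε δ)) ∧
      ((SA' δ ∪ SB' δ = (⟨D.carrier, δ, ∅, ∅⟩ : DiscreteDobrushin).zdBoundary ∧
        Disjoint (SA' δ) (SB' δ) ∧ (SA' δ).Nonempty ∧ (SB' δ).Nonempty ∧
        (∀ y ∈ SA' δ, ¬ Metric.closedBall (meshPoint δ y)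
            (Metric.infDist (meshPoint δ y) (frontier D.carrier)) ⊆
          ⋃ x ∈ SB' δ, Metric.closedBall (meshPoint δ x)
            (Metric.infDist (meshPoint δ x) (frontier D.carrier))) ∧
        (∀ x ∈ SB' δ, ¬ Metric.closedBall (meshPoint δ x)
            (Metric.infDist (meshPoint δ x) (frontier D.carrier)) ⊆
          ⋃ y ∈ SA' δ, Metric.closedBall (meshPoint δ y)
            (Metric.infDist (meshPoint δ y) (frontier D.carrier))) ∧
        (∀ y ∈ SA' δ, Metric.infDist (meshPoint δ y) ((D.chord 1 2 (by decide)).arc 0) ≤ ε δ) ∧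
        (∀ x ∈ SB' δ, Metric.infDist (meshPoint δ x) ((D.chord 1 2 (by decide)).arc 1) ≤ ε δ) ∧
        {e | e ∈ (discreteDomainGraph D.carrier δ).edgeSet ∧ (∃ x ∈ e, x ∈ SA' δ) ∧
          ∃ y ∈ e, y ∈ SB' δ}.ncard = 2 ∧
        ∀ e ∈ (discreteDomainGraph D.carrier δ).edgeSet, (∃ x ∈ e, x ∈ SA' δ) → (∃ y ∈ e, y ∈ SB' δ) →
          ∃! f, (⟨D.carrier, δ, ∅, ∅⟩ : DiscreteDobrushin).IsInnerFace f ∧ ∀ x ∈ e, IsCorner x f) ∧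
      Metric.hausdorffEDist (medialPoint δ ''
        {e | e ∈ (discreteDomainGraph D.carrier δ).edgeSet ∧ (∃ x ∈ e, x ∈ SA' δ) ∧
          ∃ y ∈ e, y ∈ SB' δ}) {D.pt 1, D.pt 2} ≤ ENNReal.ofReal (ε δ)) := by
  classical
  -- the labelling property for a Dobrushin structure `Dc` on the carrier of `D`, at mesh `δ`,
  -- tolerance `η`, with labels `SA`, `SB`
  set Q : DobrushinDomain → ℝ → ℝ → Set (Site 2) → Set (Site 2) → Prop := fun Dc δ η SA SB =>
      (SA ∪ SB = (⟨Dc.carrier, δ, ∅, ∅⟩ : DiscreteDobrushin).zdBoundary ∧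
      Disjoint SA SB ∧ SA.Nonempty ∧ SB.Nonempty ∧
      (∀ y ∈ SA, ¬ Metric.closedBall (meshPoint δ y)
          (Metric.infDist (meshPoint δ y) (frontier Dc.carrier)) ⊆
        ⋃ x ∈ SB, Metric.closedBall (meshPoint δ x)
          (Metric.infDist (meshPoint δ x) (frontier Dc.carrier))) ∧
      (∀ x ∈ SB, ¬ Metric.closedBall (meshPoint δ x)
          (Metric.infDist (meshPoint δ x) (frontier Dc.carrier)) ⊆
        ⋃ y ∈ SA, Metric.closedBall (meshPoint δ y)
          (Metric.infDist (meshPoint δ y) (frontier Dc.carrier))) ∧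
      (∀ y ∈ SA, Metric.infDist (meshPoint δ y) (Dc.arc 0) ≤ η) ∧
      (∀ x ∈ SB, Metric.infDist (meshPoint δ x) (Dc.arc 1) ≤ η) ∧
      {e | e ∈ (discreteDomainGraph Dc.carrier δ).edgeSet ∧ (∃ x ∈ e, x ∈ SA) ∧
        ∃ y ∈ e, y ∈ SB}.ncard = 2 ∧
      ∀ e ∈ (discreteDomainGraph Dc.carrier δ).edgeSet, (∃ x ∈ e, x ∈ SA) → (∃ y ∈ e, y ∈ SB) →
        ∃! f, (⟨Dc.carrier, δ, ∅, ∅⟩ : DiscreteDobrushin).IsInnerFace f ∧ ∀ x ∈ e, IsCorner x f) ∧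
      Metric.hausdorffEDist (medialPoint δ ''
        {e | e ∈ (discreteDomainGraph Dc.carrier δ).edgeSet ∧ (∃ x ∈ e, x ∈ SA) ∧
          ∃ y ∈ e, y ∈ SB}) {Dc.pt 0, Dc.pt 1} ≤ ENNReal.ofReal η with hQ
  set D₂ : DobrushinDomain := D.chord 0 2 (by decide) with hD₂
  set D₃ : DobrushinDomain := D.chord 1 2 (by decide) with hD₃
  have hev : ∀ η : ℝ, 0 < η → ∀ᶠ δ in 𝓝[>] (0 : ℝ),
      (∃ SA SB, Q D₂ δ η SA SB) ∧ ∃ SA SB, Q D₃ δ η SA SB := fun η hη =>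
    (eventually_labelling D₂ hη).and (eventually_labelling D₃ hη)
  -- the infimum trick (adapted from Theorems/CardySelfRefinementLagHandOffDiscretisable.lean, where it
  -- is inlined in `stub_discretisable`): a diagonal tolerance `ε δ → 0⁺` good for both chords
  obtain ⟨ε, hε, hgood⟩ : ∃ ε : ℝ → ℝ, Tendsto ε (𝓝[>] 0) (𝓝 0) ∧ ∀ᶠ δ in 𝓝[>] (0 : ℝ), 0 < ε δ ∧
      ((∃ SA SB, Q D₂ δ (ε δ) SA SB) ∧ ∃ SA SB, Q D₃ δ (ε δ) SA SB) := by
    set P : ℝ → ℝ → Prop := fun δ η => (∃ SA SB, Q D₂ δ η SA SB) ∧ ∃ SA SB, Q D₃ δ η SA SB with hP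
    set G : ℝ → Set ℝ := fun δ => {η | 0 < η ∧ P δ η} with hG
    have hbdd : ∀ δ, BddBelow (G δ) := fun δ => ⟨0, fun η hη => hη.1.le⟩
    set ε : ℝ → ℝ := fun δ =>
      if hx : ∃ η, η ∈ G δ ∧ η < sInf (G δ) + δ then Classical.choose hx else 1 with hεd
    have hmem : ∀ η : ℝ, 0 < η → ∀ᶠ δ in 𝓝[>] (0 : ℝ), η ∈ G δ := fun η hη =>
      (hev η hη).mono fun δ hδ => ⟨hη, hδ⟩
    have hpos : ∀ᶠ δ in 𝓝[>] (0 : ℝ), 0 < δ := self_mem_nhdsWithin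
    have hchoice : ∀ᶠ δ in 𝓝[>] (0 : ℝ), ε δ ∈ G δ ∧ ε δ < sInf (G δ) + δ := by
      filter_upwards [hmem 1 one_pos, hpos] with δ h1 hδ
      have hx : ∃ η, η ∈ G δ ∧ η < sInf (G δ) + δ := by
        obtain ⟨η, hη, hlt⟩ := exists_lt_of_csInf_lt ⟨1, h1⟩ (lt_add_of_pos_right _ hδ)
        exact ⟨η, hη, hlt⟩
      have : ε δ = Classical.choose hx := by rw [hεd]; exact dif_pos hx
      rw [this]
      exact Classical.choose_spec hx
    refine ⟨ε, ?_, hchoice.mono fun δ hδ => ⟨hδ.1.1, hδ.1.2⟩⟩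
    rw [Metric.tendsto_nhds]
    intro e he
    filter_upwards [hchoice, hmem (e / 2) (by positivity),
      Ioo_mem_nhdsGT (show (0 : ℝ) < e / 2 by positivity)] with δ hc h2 hδ
    have hinf : sInf (G δ) ≤ e / 2 := csInf_le (hbdd δ) h2
    rw [Real.dist_eq, sub_zero, abs_of_pos hc.1.1]
    linarith [hc.2, hδ.2]
  obtain ⟨SA, SB, h₂⟩ := exists_fun₂_of_eventually_exists (hgood.mono fun δ h => h.2.1)
  obtain ⟨SA', SB', h₃⟩ := exists_fun₂_of_eventually_exists (hgood.mono fun δ h => h.2.2)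
  refine ⟨SA, SB, SA', SB', ε, hε, ?_⟩
  filter_upwards [hgood, h₂, h₃] with δ hg hq₂ hq₃
  exact ⟨hg.1, hq₂, hq₃⟩

/-! ### Registered sub-goal (one-line signature, verbatim) -/

/-- **Registered sub-goal `stub_discreteSplitting_labels` of `stub_discreteSplitting`**:
`splitting_labels`, fully quantified. -/
theorem stub_discreteSplitting_labels : ∀ D : MarkedDomain 3, ∃ (SA SB SA' SB' : ℝ → Set (Site 2)) (ε : ℝ → ℝ), Tendsto ε (𝓝[>] 0) (𝓝 0) ∧ ∀ᶠ δ in 𝓝[>] (0 : ℝ), 0 < ε δ ∧ ((SA δ ∪ SB δ = (⟨D.carrier, δ, ∅, ∅⟩ : DiscreteDobrushin).zdBoundary ∧ Disjoint (SA δ) (SB δ) ∧ (SA δ).Nonempty ∧ (SB δ).Nonempty ∧ (∀ y ∈ SA δ, ¬ Metric.closedBall (meshPoint δ y) (Metric.infDist (meshPoint δ y) (frontier D.carrier)) ⊆ ⋃ x ∈ SB δ, Metric.closedBall (meshPoint δ x) (Metric.infDist (meshPoint δ x) (frontier D.carrier))) ∧ (∀ x ∈ SB δ, ¬ Metric.closedBall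 (meshPoint δ x) (Metric.infDist (meshPoint δ x) (frontier D.carrier)) ⊆ ⋃ y ∈ SA δ, Metric.closedBall (meshPoint δ y) (Metric.infDist (meshPoint δ y) (frontier D.carrier))) ∧ (∀ y ∈ SA δ, Metric.infDist (meshPoint δ y) ((D.chord 0 2 (by decide)).arc 0) ≤ ε δ) ∧ (∀ x ∈ SB δ, Metric.infDist (meshPoint δ x) ((D.chord 0 2 (by decide)).arc 1) ≤ ε δ) ∧ {e | e ∈ (discreteDomainGraph D.carrier δ).edgeSet ∧ (∃ x ∈ e, x ∈ SA δ) ∧ ∃ y ∈ e, y ∈ SB δ}.ncard = 2 ∧ ∀ e ∈ (discreteDomainGraph D.carrier δ).edgeSet, (∃ x ∈ e, x ∈ SA δ) → (∃ y ∈ e, y ∈ SB δ) → ∃! f, (⟨D.carrier, δ, ∅, ∅⟩ : DiscreteDobrushin).IsInnerFace f ∧ ∀ x ∈ e, IsCorner x f) ∧ Metric.hausdorffEDist (medialPoint δ '' {e | e ∈ (discreteDomainGraph D.carrier δ).edgeSet ∧ (∃ x ∈ e, x ∈ SA δ) ∧ ∃ y ∈ e, y ∈ SB δ}) {D.pt 0,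 D.pt 2} ≤ ENNReal.ofReal (ε δ)) ∧ ((SA' δ ∪ SB' δ = (⟨D.carrier, δ, ∅, ∅⟩ : DiscreteDobrushin).zdBoundary ∧ Disjoint (SA' δ) (SB' δ) ∧ (SA' δ).Nonempty ∧ (SB' δ).Nonempty ∧ (∀ y ∈ SA' δ, ¬ Metric.closedBall (meshPoint δ y) (Metric.infDist (meshPoint δ y) (frontier D.carrier)) ⊆ ⋃ x ∈ SB' δ, Metric.closedBall (meshPoint δ x) (Metric.infDist (meshPoint δ x) (frontier D.carrier))) ∧ (∀ x ∈ SB' δ, ¬ Metric.closedBall (meshPoint δ x) (Metric.infDist (meshPoint δ x) (frontier D.carrier)) ⊆ ⋃ y ∈ SA' δ, Metric.closedBall (meshPoint δ y) (Metric.infDist (meshPoint δ y) (frontier D.carrier))) ∧ (∀ y ∈ SA' δ, Metric.infDist (meshPoint δ y) ((D.chord 1 2 (by decide)).arc 0) ≤ ε δ) ∧ (∀ x ∈ SB' δ, Metric.infDist (meshPoint δ x) ((D.chord 1 2 (by decide)).arc 1) ≤ ε δ) ∧ {e | e ∈ (discreteDomainGraph D.carrier δ).edgeSet ∧ (∃ x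 ∈ e, x ∈ SA' δ) ∧ ∃ y ∈ e, y ∈ SB' δ}.ncard = 2 ∧ ∀ e ∈ (discreteDomainGraph D.carrier δ).edgeSet, (∃ x ∈ e, x ∈ SA' δ) → (∃ y ∈ e, y ∈ SB' δ) → ∃! f, (⟨D.carrier, δ, ∅, ∅⟩ : DiscreteDobrushin).IsInnerFace f ∧ ∀ x ∈ e, IsCorner x f) ∧ Metric.hausdorffEDist (medialPoint δ '' {e | e ∈ (discreteDomainGraph D.carrier δ).edgeSet ∧ (∃ x ∈ e, x ∈ SA' δ) ∧ ∃ y ∈ e, y ∈ SB' δ}) {D.pt 1, D.pt 2} ≤ ENNReal.ofReal (ε δ)) :=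
  fun D => splitting_labels D

end Summit.CriticalPhenomena.CardyFormulaZ2.Cruxes.LagHandOff.HittingTournament

end
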